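/-
[OURS · L1 W4.5(b) · EL♮(3)] SPECIMEN-TC⁺ (quartic, one inner step (i)) — local chart algebra of the inner step on `Spec DL`.
-/
import Summits.ResolutionOfSingularities.ResolutionOfSingularities.Theorems.EquisingularLiftEquisingularLiftNatSpecimenQuarticTcPlusHypersurfacePoint
import Summits.ResolutionOfSingularities.ResolutionOfSingularities.Theorems.EquisingularLiftEquisingularLiftNatSpecimenQuarticTcPlusInnerRings
import Summits.ResolutionOfSingularities.ResolutionOfSingularities.Theorems.EquisingularLiftEquisingularLiftNatSpecimenQuarticTcDeltaLocalTwoStep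
import HarnessLib

/-!
# [OURS · L1 W4.5(b) · EL♮(3)] SPECIMEN-TC⁺ for the quartic — part L1: CHART ALGEBRA of the INNER step on `Spec DL`,
# `DL = k[y₀,y₁,y₂]/(y₂² + y₁²(1 + y₀⁴))`
# (crux `EquisingularLiftNatThree` = stmt-ResolutionOfSingularities-20148; res-L1-w45b-lead-2 DEALS (D2) 2026-08-27T11:55:26Z «NON-VACUITY
# CERTIFICATES TC⁺»; scoping memo D/res-D-pv-034/SPECIMEN-TCPLUS-SCOPE.md §1/§5; helper, closes nothing)

HONEST FRAMING. OURS (cell `res-hironaka`, chain w45b, slot W4.5(b)); NOT a statement of any manuscript; AI-written, weaker than expert review.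

The inner step of the cheapest TC⁺ certificate blows up the origin `ptL` of `Spec DL` (`DL` = the `x`-chart of the point step of the quartic,
`…TcDeltaLocalCharts`) and then the strict transform of the carrier LINE `V(cenL) = V(ȳ₁, ȳ₂)`. On the three Stacks-0804 charts
`Spec DL[𝔪₀/ȳⱼ]` (`BchL j` of `…TcPlusInnerRings` = `BchF k (gL k) j` of `…TcPlusHypersurfacePoint`) the pulled-back second centre is the
closure of `V(cenL · DL[𝔪₀/ȳⱼ]) ∖ V(ȳⱼ/1)`:
* `j = 1, 2`: EMPTY (`ȳ₁` resp. `ȳ₂` is a generator of `cenL` AND the exceptional generator) — `centre_chart₁/₂_eq_empty`; the chart rings are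
  the smooth surfaces `k[X]/(gInner₁)`, `k[X]/(gInner₂)` (`nonempty_innerChart₁/₂_equiv`, `isRegularRing_BchL₁/₂`);
* `j = 0` (self-similar, `ε : DL ≅ DL[𝔪₀/ȳ₀]` of `exists_innerChart₀_equiv_track`): `V(ε cenL)` (`closure_centre_chart₀`, `vanishingIdeal_centre_chart₀`),
  whose blow-up charts are the landed regular LINE-STEP rings (`isRegularRing_lineChart_map'`).

References: The Stacks Project, Tags 0804, 052Q, 080E; Görtz–Wedhorn I Prop. 13.96 (2).
-/

set_option linter.dupNamespace false -- mandated namespace `Summit.<Summit>.<Problem>` of this single-conjunct summit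

noncomputable section

open CategoryTheory CategoryTheory.Limits AlgebraicGeometry TopologicalSpace
open MvPolynomial
open Literature.AlgebraicGeometry.Resolution
open AlgebraicGeometry.Scheme.IdealSheafData
open Summit.ResolutionOfSingularities.ResolutionOfSingularities.Theorems.EquisingularLift

namespace Summit.ResolutionOfSingularities.ResolutionOfSingularities.Cruxes.EquisingularLiftNat.Sections

namespace SpecimenQuarticTcPlus

open SpecimenQuarticTcDelta

universe u

variable (k : Type) [Field k]

/-! ## The origin of `Spec DL` and the carrier line `V(cenL)` -/

/-- `gL = y₂² + y₁²(1 + y₀⁴) ∈ 𝔪₀`. [folklore] -/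
theorem gL_mem_originIdeal : gL k ∈ PointBlowup.originIdeal 2 k := by
  have h1 : (X 1 : MvPolynomial (Fin 3) k) ∈ PointBlowup.originIdeal 2 k := Ideal.subset_span (Set.mem_range_self 1)
  have h2 : (X 2 : MvPolynomial (Fin 3) k) ∈ PointBlowup.originIdeal 2 k := Ideal.subset_span (Set.mem_range_self 2)
  have e : gL k = X 2 * X 2 + X 1 * (X 1 * (1 + X 0 ^ 4)) := by simp only [gL]; ring
  rw [e]
  exact Ideal.add_mem _ (Ideal.mul_mem_left _ _ h2) (Ideal.mul_mem_left _ _ (Ideal.mul_mem_right _ _ h1))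

/-- The origin `ptL = (ȳ₀, ȳ₁, ȳ₂)` of `Spec DL` (the inner centre). [folklore] -/
abbrev ptL : Spec (CommRingCat.of (DL k)) := ptF k (gL_mem_originIdeal k)

/-- `gL ∈ (y₁, y₂)`: the carrier line lies on the surface. [folklore] -/
theorem gL_mem_span_cen : gL k ∈ Ideal.span (Set.range (WhitneyCubic.cen k)) := by
  rw [SpecimenQuartic.span_range_cen_eq_pair]
  have h1 : (X 1 : MvPolynomial (Fin 3) k) ∈ Ideal.span {(X 1 : MvPolynomial (Fin 3) k), X 2} := Ideal.subset_span (by simp)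
  have h2 : (X 2 : MvPolynomial (Fin 3) k) ∈ Ideal.span {(X 1 : MvPolynomial (Fin 3) k), X 2} := Ideal.subset_span (by simp)
  have e : gL k = X 2 * X 2 + X 1 * (X 1 * (1 + X 0 ^ 4)) := by simp only [gL]; ring
  rw [e]
  exact Ideal.add_mem _ (Ideal.mul_mem_left _ _ h2) (Ideal.mul_mem_left _ _ (Ideal.mul_mem_right _ _ h1))

/-- `cenL = (ȳ₁, ȳ₂) ⊂ DL` is prime (`DL/cenL ≅ k[y]/(y₁, y₂) ≅ k[y₀]`). [folklore] -/
theorem isPrime_cenL : (cenL k).IsPrime := by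
  haveI := SpecimenQuartic.isPrime_span_cen k
  refine Ideal.map_isPrime_of_surjective Ideal.Quotient.mk_surjective ?_
  rw [Ideal.mk_ker, Ideal.span_le, Set.singleton_subset_iff]
  exact gL_mem_span_cen k

/-- `cenL` pulled back to `k[y]` is `(y₁, y₂)`. [folklore] -/
theorem comap_cenL : (cenL k).comap (Ideal.Quotient.mk (Ideal.span {gL k})) = Ideal.span (Set.range (WhitneyCubic.cen k)) := by
  rw [cenL, Ideal.comap_map_of_surjective _ Ideal.Quotient.mk_surjective, ← RingHom.ker_eq_comap_bot, Ideal.mk_ker]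
  refine sup_eq_left.mpr ?_
  rw [Ideal.span_le, Set.singleton_subset_iff]
  exact gL_mem_span_cen k

/-- `y₀ ∉ (y₁, y₂)`. [folklore] -/
theorem X_zero_not_mem_span_cen : (X 0 : MvPolynomial (Fin 3) k) ∉ Ideal.span (Set.range (WhitneyCubic.cen k)) := by
  rw [WhitneyCubic.range_cen, MvPolynomial.mem_ideal_span_X_image]
  intro h
  obtain ⟨i, hi, hne⟩ := h (Finsupp.single 0 1) (by simp)
  simp only [Set.mem_insert_iff, Set.mem_singleton_iff] at hi
  rcases hi with rfl | rfl <;> simp at hne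

/-- `ȳ₀ ∉ cenL`. [folklore] -/
theorem gbarL_zero_not_mem_cenL : gbarL k 0 ∉ cenL k := by
  intro h
  have h' : (X 0 : MvPolynomial (Fin 3) k) ∈ (cenL k).comap (Ideal.Quotient.mk (Ideal.span {gL k})) := h
  rw [comap_cenL] at h'
  exact X_zero_not_mem_span_cen k h'

/-- `ȳ₁ ∈ cenL`, `ȳ₂ ∈ cenL`. [folklore] -/
theorem gbarL_mem_cenL (i : Fin 2) : gbarL k (Fin.succ i) ∈ cenL k := by
  refine Ideal.mem_map_of_mem _ (Ideal.subset_span ⟨i, ?_⟩)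
  fin_cases i <;> rfl

/-! ## The second centre read on the three charts of the inner point blow-up -/

/-- **Chart `ȳ₁`**: the pulled-back centre set `V(cenL · DL[𝔪₀/ȳ₁]) ∖ V(ȳ₁/1)` is EMPTY. [OURS · SPECIMEN-TC⁺ (i) local] [folklore] -/
theorem centre_chart₁_eq_empty :
    PrimeSpectrum.zeroLocus (((cenL k).map (algebraMap (DL k) (BchL k 1))) : Set (BchL k 1)) \
      PrimeSpectrum.zeroLocus {excL k 1} = ∅ :=
  zeroLocus_diff_eq_empty_of_mem (Ideal.mem_map_of_mem _ (gbarL_mem_cenL k 0))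

/-- **Chart `ȳ₂`**: the pulled-back centre set `V(cenL · DL[𝔪₀/ȳ₂]) ∖ V(ȳ₂/1)` is EMPTY. [OURS · SPECIMEN-TC⁺ (i) local] [folklore] -/
theorem centre_chart₂_eq_empty :
    PrimeSpectrum.zeroLocus (((cenL k).map (algebraMap (DL k) (BchL k 2))) : Set (BchL k 2)) \
      PrimeSpectrum.zeroLocus {excL k 2} = ∅ :=
  zeroLocus_diff_eq_empty_of_mem (Ideal.mem_map_of_mem _ (gbarL_mem_cenL k 1))

/-- `cenL · B = (ȳ₁·1, ȳ₂·1)` in any `DL`-algebra `B`. [folklore] -/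
theorem map_cenL_algebraMap_eq {B : Type} [CommRing B] [Algebra (DL k) B] :
    (cenL k).map (algebraMap (DL k) B) = Ideal.span {algebraMap (DL k) B (gbarL k 1), algebraMap (DL k) B (gbarL k 2)} := by
  rw [cenL, Ideal.map_map, SpecimenQuartic.span_range_cen_eq_pair, Ideal.map_span, Set.image_pair]
  rfl

/-- The image of `cenL` under a ring map as the span of a `Fin 2`-family (input form of `exists_chart_of_span_range_eq`). [folklore] -/
theorem map_cenL_eq_span_range' {B : Type} [CommRing B] (ε : DL k →+* B) :
    (cenL k).map ε = Ideal.span (Set.range fun i : Fin 2 => ε (Ideal.Quotient.mk (Ideal.span {gL k}) (WhitneyCubic.cen k i))) := by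
  rw [cenL, Ideal.map_map, Ideal.map_span, ← Set.range_comp]
  rfl

/-- The image of `cenL` under a ring map as a pair span. [folklore] -/
theorem map_cenL_eq_pair {B : Type} [CommRing B] (ε : DL k →+* B) :
    (cenL k).map ε = Ideal.span {ε (gbarL k 1), ε (gbarL k 2)} := by
  rw [cenL, Ideal.map_map, SpecimenQuartic.span_range_cen_eq_pair, Ideal.map_span, Set.image_pair]
  rfl

/-- **Chart `ȳ₀` (self-similar)**: with `ε : DL ≅ DL[𝔪₀/ȳ₀]`, `ε ȳ₀ = ȳ₀/1`, `ε ȳ₁ = ȳ₁/ȳ₀`, `ε ȳ₂ = ȳ₂/ȳ₀`, the pulled-back centre set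
`V(cenL · DL[𝔪₀/ȳ₀]) ∖ V(ȳ₀/1)` equals `V(ε cenL) ∖ V(ȳ₀/1)`. [OURS · SPECIMEN-TC⁺ (i) local] [cite: StacksProject, Tag 080E] -/
theorem centre_chart₀_eq (ε : DL k ≃+* BchL k 0) (hε1 : ε (gbarL k 1) = frL k 0 1) (hε2 : ε (gbarL k 2) = frL k 0 2) :
    PrimeSpectrum.zeroLocus (((cenL k).map (algebraMap (DL k) (BchL k 0))) : Set (BchL k 0)) \
      PrimeSpectrum.zeroLocus {excL k 0} =
    PrimeSpectrum.zeroLocus (((cenL k).map ε.toRingHom) : Set (BchL k 0)) \ PrimeSpectrum.zeroLocus {excL k 0} := by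
  rw [map_cenL_algebraMap_eq, map_cenL_eq_pair, PrimeSpectrum.zeroLocus_span, PrimeSpectrum.zeroLocus_span]
  change PrimeSpectrum.zeroLocus {algebraMap (DL k) (BchL k 0) (gbarL k 1), algebraMap (DL k) (BchL k 0) (gbarL k 2)} \ _ =
    PrimeSpectrum.zeroLocus {ε (gbarL k 1), ε (gbarL k 2)} \ _
  rw [show algebraMap (DL k) (BchL k 0) (gbarL k 1) = excL k 0 * frL k 0 1 from algebraMap_gbarF_eq k (gL k) 0 1,
    show algebraMap (DL k) (BchL k 0) (gbarL k 2) = excL k 0 * frL k 0 2 from algebraMap_gbarF_eq k (gL k) 0 2,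
    zeroLocus_pair_mul_diff, hε1, hε2]

/-- `ε cenL` is prime and misses `ȳ₀/1 = ε ȳ₀`. [folklore] -/
theorem isPrime_map_cenL (ε : DL k ≃+* BchL k 0) : ((cenL k).map ε.toRingHom).IsPrime := by
  haveI := isPrime_cenL k
  exact Ideal.map_isPrime_of_equiv ε

/-- `ȳ₀/1 ∉ ε cenL`. [folklore] -/
theorem excL_zero_not_mem_map_cenL (ε : DL k ≃+* BchL k 0) (hε0 : ε (gbarL k 0) = excL k 0) :
    excL k 0 ∉ (cenL k).map ε.toRingHom := by
  rw [← hε0]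
  intro h
  apply gbarL_zero_not_mem_cenL k
  have h' : ε.symm (ε (gbarL k 0)) ∈ ((cenL k).map ε.toRingHom).map ε.symm.toRingHom := Ideal.mem_map_of_mem _ h
  rw [ε.symm_apply_apply, Ideal.map_map] at h'
  have hid : ε.symm.toRingHom.comp ε.toRingHom = RingHom.id _ := RingHom.ext fun a => ε.symm_apply_apply a
  rwa [hid, Ideal.map_id] at h'

/-- **Chart `ȳ₀`**: the closure of the pulled-back centre set is `V(ε cenL)` — the strict transform of the carrier line is the line again.
[OURS · SPECIMEN-TC⁺ (i) local] [cite: StacksProject, Tag 080E] -/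
theorem closure_centre_chart₀ (ε : DL k ≃+* BchL k 0) (hε0 : ε (gbarL k 0) = excL k 0) (hε1 : ε (gbarL k 1) = frL k 0 1)
    (hε2 : ε (gbarL k 2) = frL k 0 2) :
    closure (PrimeSpectrum.zeroLocus (((cenL k).map (algebraMap (DL k) (BchL k 0))) : Set (BchL k 0)) \
      PrimeSpectrum.zeroLocus {excL k 0}) =
    PrimeSpectrum.zeroLocus (((cenL k).map ε.toRingHom) : Set (BchL k 0)) := by
  rw [centre_chart₀_eq k ε hε1 hε2]
  haveI := isPrime_map_cenL k ε
  exact closure_zeroLocus_diff_eq_of_isPrime _ (excL_zero_not_mem_map_cenL k ε hε0)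

/-- **Chart `ȳ₀`**: the ideal sheaf of the reduced structure on `V(ε cenL)` is `(ε cenL)~`. [cite: Hartshorne1977, II Example 3.2.6] -/
theorem vanishingIdeal_centre_chart₀ (ε : DL k ≃+* BchL k 0) :
    vanishingIdeal (⟨PrimeSpectrum.zeroLocus (((cenL k).map ε.toRingHom) : Set (BchL k 0)), PrimeSpectrum.isClosed_zeroLocus _⟩ :
      Closeds (Spec (CommRingCat.of (BchL k 0)))) =
      ofIdealTop (((cenL k).map ε.toRingHom).map (Scheme.ΓSpecIso (CommRingCat.of (BchL k 0))).inv.hom) := by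
  have h := vanishingIdeal_zeroLocus_Spec (CommRingCat.of (BchL k 0)) (((cenL k).map ε.toRingHom) : Set (BchL k 0))
  haveI := isPrime_map_cenL k ε
  rw [Ideal.span_eq, Ideal.IsPrime.radical inferInstance] at h
  exact h

/-! ## The regular rings on the charts -/

/-- The LINE-STEP chart rings moved along any presentation `ε : DL ≅ B` are regular (stub-4 `isRegularRing_lineChart₀/₁`, p510354, +
`blowupAlgebra.congrEquiv`; `…TcDeltaLocalTwoStep.isRegularRing_lineChart_map` with a general target). [OURS · T-ISO-1 plumbing] -/
theorem isRegularRing_lineChart_map' (h2 : IsUnit (2 : k)) {B : Type} [CommRing B] (ε : DL k ≃+* B) (i : Fin 2) :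
    IsRegularRing (blowupAlgebra ((cenL k).map ε.toRingHom)
      (ε.toRingHom (Ideal.Quotient.mk (Ideal.span {gL k}) (WhitneyCubic.cen k i)))) := by
  have hreg : IsRegularRing (blowupAlgebra (cenL k) (Ideal.Quotient.mk (Ideal.span {gL k}) (WhitneyCubic.cen k i))) := by
    fin_cases i
    · exact SpecimenQuartic.isRegularRing_lineChart₀ k h2
    · exact SpecimenQuartic.isRegularRing_lineChart₁ k h2
  haveI := hreg
  exact IsRegularRing.of_ringEquiv (blowupAlgebra.congrEquiv ε (cenL k) (Ideal.Quotient.mk (Ideal.span {gL k}) (WhitneyCubic.cen k i)))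

/-- **`k[X]/(gInner₁) ≅ DL[𝔪₀/ȳ₁]`**: the `ȳ₁`-chart of the inner point step is the smooth surface `t² + 1 + y₁⁴a⁴`
(`gL = y₁² · gInner₁(a, y₁, t)` with `y₀ = y₁a`, `y₂ = y₁t`). [OURS · SPECIMEN-TC⁺ (i) local] [cite: GortzWedhorn2020, Prop. 13.96 (2)] -/
theorem nonempty_innerChart₁_equiv : Nonempty ((MvPolynomial (Fin 3) k ⧸ Ideal.span {gInner₁ k}) ≃+* BchL k 1) := by
  obtain ⟨θ, hθ1, hθj⟩ := SpecimenQuartic.exists_ringEquiv_pointChart k 1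
  have h0 : θ (X 0) = PointBlowup.frac 2 k 1 0 := hθj 0 (by decide)
  have h2 : θ (X 2) = PointBlowup.frac 2 k 1 2 := hθj 2 (by decide)
  set G : MvPolynomial {j : Fin 3 // j ≠ 1} (MvPolynomial (Fin 3) k) :=
    X ⟨2, by decide⟩ ^ 2 + 1 + C (X 1 ^ 4) * X ⟨0, by decide⟩ ^ 4 with hG
  have hev : blowupAlgebra.eval (MvPolynomial.X : Fin 3 → MvPolynomial (Fin 3) k) 1 G =
      PointBlowup.frac 2 k 1 2 ^ 2 + 1 + PointBlowup.exc 2 k 1 ^ 4 * PointBlowup.frac 2 k 1 0 ^ 4 := by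
    simp only [hG, map_add, map_pow, map_mul, map_one, blowupAlgebra.eval_X, blowupAlgebra.eval_C]
  have hθg : θ (gInner₁ k) = blowupAlgebra.eval (MvPolynomial.X : Fin 3 → MvPolynomial (Fin 3) k) 1 G := by
    rw [hev, gInner₁, map_add, map_add, map_pow, h2, map_one, map_mul, map_pow, map_pow, hθ1, h0]
  have hf : algebraMap (MvPolynomial (Fin 3) k) (PointBlowup.Chart 2 k 1) (gL k) =
      algebraMap (MvPolynomial (Fin 3) k) (PointBlowup.Chart 2 k 1) (X 1) ^ 2 *
        blowupAlgebra.eval (MvPolynomial.X : Fin 3 → MvPolynomial (Fin 3) k) 1 G := by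
    rw [hev, gL, map_add, map_mul, map_pow, map_pow, map_add, map_one, map_pow, PointBlowup.algebraMap_X 2 k 1 2,
      PointBlowup.algebraMap_X 2 k 1 0]
    change _ = PointBlowup.exc 2 k 1 ^ 2 * _
    ring
  have hndvd : ¬ algebraMap (MvPolynomial (Fin 3) k) (PointBlowup.Chart 2 k 1) (X 1) ∣
      blowupAlgebra.eval (MvPolynomial.X : Fin 3 → MvPolynomial (Fin 3) k) 1 G := by
    intro h
    have hm := (blowupAlgebra.eval_mem_span_algebraMap_iff (MvPolynomial.X : Fin 3 → MvPolynomial (Fin 3) k) 1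
      (SpecimenQuartic.isQuasiRegular_X k) G).mp (Ideal.mem_span_singleton.mpr h) (Finsupp.single ⟨2, by decide⟩ 2)
    have hc : G.coeff (Finsupp.single ⟨2, by decide⟩ 2) = 1 := by
      classical
      rw [hG, coeff_add, coeff_add, coeff_X_pow, if_pos rfl, coeff_one, if_neg, coeff_C_mul, coeff_X_pow, if_neg]
      · ring
      · intro h0'
        have := congrArg (fun e : {j : Fin 3 // j ≠ 1} →₀ ℕ => e ⟨2, by decide⟩) h0'
        simp at this
      · intro h0'
        have := congrArg (fun e : {j : Fin 3 // j ≠ 1} →₀ ℕ => e ⟨2, by decide⟩) h0'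
        simp at this
    rw [hc] at hm
    haveI := SpecimenQuartic.isDomain_quotient_origin k
    exact ((Ideal.Quotient.isDomain_iff_prime _).mp inferInstance).ne_top ((Ideal.eq_top_iff_one _).mpr hm)
  have hmap : Ideal.map θ (Ideal.span {gInner₁ k}) =
      Ideal.span {blowupAlgebra.eval (MvPolynomial.X : Fin 3 → MvPolynomial (Fin 3) k) 1 G} := by
    rw [Ideal.map_span, Set.image_singleton]
    exact congrArg _ (congrArg _ hθg)
  exact ⟨(Ideal.quotientEquiv _ _ θ hmap.symm).trans
    (blowupAlgebra.quotientKerMapQuotientEquiv _ _ hf (SpecimenQuartic.prime_exc k 1) hndvd)⟩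

/-- **`k[X]/(gInner₂) ≅ DL[𝔪₀/ȳ₂]`**: the `ȳ₂`-chart of the inner point step is the smooth surface `1 + b²(1 + y₂⁴a⁴)`
(`gL = y₂² · gInner₂(a, b, y₂)` with `y₀ = y₂a`, `y₁ = y₂b`). [OURS · SPECIMEN-TC⁺ (i) local] [cite: GortzWedhorn2020, Prop. 13.96 (2)] -/
theorem nonempty_innerChart₂_equiv : Nonempty ((MvPolynomial (Fin 3) k ⧸ Ideal.span {gInner₂ k}) ≃+* BchL k 2) := by
  obtain ⟨θ, hθ2, hθj⟩ := SpecimenQuartic.exists_ringEquiv_pointChart k 2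
  have h0 : θ (X 0) = PointBlowup.frac 2 k 2 0 := hθj 0 (by decide)
  have h1 : θ (X 1) = PointBlowup.frac 2 k 2 1 := hθj 1 (by decide)
  set G : MvPolynomial {j : Fin 3 // j ≠ 2} (MvPolynomial (Fin 3) k) :=
    1 + X ⟨1, by decide⟩ ^ 2 * (1 + C (X 2 ^ 4) * X ⟨0, by decide⟩ ^ 4) with hG
  have hev : blowupAlgebra.eval (MvPolynomial.X : Fin 3 → MvPolynomial (Fin 3) k) 2 G =
      1 + PointBlowup.frac 2 k 2 1 ^ 2 * (1 + PointBlowup.exc 2 k 2 ^ 4 * PointBlowup.frac 2 k 2 0 ^ 4) := by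
    simp only [hG, map_add, map_pow, map_mul, map_one, blowupAlgebra.eval_X, blowupAlgebra.eval_C]
  have hθg : θ (gInner₂ k) = blowupAlgebra.eval (MvPolynomial.X : Fin 3 → MvPolynomial (Fin 3) k) 2 G := by
    rw [hev, gInner₂, map_add, map_one, map_mul, map_pow, h1, map_add, map_one, map_mul, map_pow, map_pow, hθ2, h0]
  have hf : algebraMap (MvPolynomial (Fin 3) k) (PointBlowup.Chart 2 k 2) (gL k) =
      algebraMap (MvPolynomial (Fin 3) k) (PointBlowup.Chart 2 k 2) (X 2) ^ 2 *
        blowupAlgebra.eval (MvPolynomial.X : Fin 3 → MvPolynomial (Fin 3) k) 2 G := by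
    rw [hev, gL, map_add, map_mul, map_pow, map_pow, map_add, map_one, map_pow, PointBlowup.algebraMap_X 2 k 2 1,
      PointBlowup.algebraMap_X 2 k 2 0]
    change PointBlowup.exc 2 k 2 ^ 2 + _ = PointBlowup.exc 2 k 2 ^ 2 * _
    ring
  have hndvd : ¬ algebraMap (MvPolynomial (Fin 3) k) (PointBlowup.Chart 2 k 2) (X 2) ∣
      blowupAlgebra.eval (MvPolynomial.X : Fin 3 → MvPolynomial (Fin 3) k) 2 G := by
    intro h
    have hm := (blowupAlgebra.eval_mem_span_algebraMap_iff (MvPolynomial.X : Fin 3 → MvPolynomial (Fin 3) k) 2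
      (SpecimenQuartic.isQuasiRegular_X k) G).mp (Ideal.mem_span_singleton.mpr h) 0
    have hc : G.coeff 0 = 1 := by
      classical
      rw [hG, coeff_add, coeff_one, if_pos rfl, coeff_mul, Finsupp.antidiagonal_zero, Finset.sum_singleton, coeff_X_pow, if_neg,
        zero_mul, add_zero]
      intro h0'
      have := congrArg (fun e : {j : Fin 3 // j ≠ 2} →₀ ℕ => e ⟨1, by decide⟩) h0'
      simp at this
    rw [hc] at hm
    haveI := SpecimenQuartic.isDomain_quotient_origin k
    exact ((Ideal.Quotient.isDomain_iff_prime _).mp inferInstance).ne_top ((Ideal.eq_top_iff_one _).mpr hm)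
  have hmap : Ideal.map θ (Ideal.span {gInner₂ k}) =
      Ideal.span {blowupAlgebra.eval (MvPolynomial.X : Fin 3 → MvPolynomial (Fin 3) k) 2 G} := by
    rw [Ideal.map_span, Set.image_singleton]
    exact congrArg _ (congrArg _ hθg)
  exact ⟨(Ideal.quotientEquiv _ _ θ hmap.symm).trans
    (blowupAlgebra.quotientKerMapQuotientEquiv _ _ hf (SpecimenQuartic.prime_exc k 2) hndvd)⟩

/-- **`DL[𝔪₀/ȳ₁]` is a regular ring** (`char k ≠ 2`). [OURS · SPECIMEN-TC⁺ (i) local] [cite: StacksProject, Tag 07PF] -/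
theorem isRegularRing_BchL₁ (h2 : IsUnit (2 : k)) : IsRegularRing (BchL k 1) := by
  obtain ⟨ε⟩ := nonempty_innerChart₁_equiv k
  haveI := isRegularRing_quotient_innerChart₁ k h2
  exact IsRegularRing.of_ringEquiv ε

/-- **`DL[𝔪₀/ȳ₂]` is a regular ring** (`char k ≠ 2`). [OURS · SPECIMEN-TC⁺ (i) local] [cite: StacksProject, Tag 07PF] -/
theorem isRegularRing_BchL₂ (h2 : IsUnit (2 : k)) : IsRegularRing (BchL k 2) := by
  obtain ⟨ε⟩ := nonempty_innerChart₂_equiv k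
  haveI := isRegularRing_quotient_innerChart₂ k h2
  exact IsRegularRing.of_ringEquiv ε

end SpecimenQuarticTcPlus

end Summit.ResolutionOfSingularities.ResolutionOfSingularities.Cruxes.EquisingularLiftNat.Sections
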